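import Mathlib.CategoryTheory.Monoidal.Cartesian.Over
import Literature.AlgebraicGeometry.Motives.ZariskiConnectednessDVR
import Literature.AlgebraicGeometry.Motives.AbelianVariety
import HarnessLib

/-!
# The special fibre of a proper smooth group scheme over a Dedekind domain is an abelian variety

Let `R` be a Dedekind domain with fraction field `K`, `q : R ↠ k₀` a surjection onto a field with
non-zero kernel (a closed point `𝔪 = ker q` of `Spec R`, `k₀ ≅ κ(𝔪)`), and `𝒜 → Spec R` a proper smooth
`R`-group scheme whose generic fibre `𝒜_K` is geometrically irreducible — e.g. isomorphic to (the
underlying scheme of) an abelian variety over `K`, which is the output of the tree's spreading-out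
theorem `Literature.NumberTheory.EllipticCurves.exists_abelianScheme_away_holds` (Milne, *Abelian
Varieties*, Rem. 20.9; BLR, *Néron Models*, 1.4/3).  Then the special fibre `𝒜 ×_R k₀`, with its
group structure by base change, is an ABELIAN VARIETY over `k₀` (Serre–Tate, *Good reduction of
abelian varieties*, §1: "the special fibre `A_v` is an abelian variety over `k(v)`"; here over an
arbitrary Dedekind base):

* `specialFibreFunctor q` — `𝒳 ↦ 𝒳 ×_R k₀`, Mathlib's `Over.pullback` along `Spec k₀ → Spec R`
  (monoidal for the cartesian structures, so group schemes go to group schemes, `Functor.grpObjObj`);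
* `geometricallyIrreducible_genericFibre_of_iso` — `𝒜_K` is geometrically irreducible as soon as it
  is `K`-isomorphic to a geometrically integral `K`-scheme (transport along the `Over`-isomorphism);
* `specialFibreAbelianVariety q hq hq0 𝒜 : AbelianVariety k₀` — proper by base change, geometrically
  integral by Zariski's connectedness theorem over the Dedekind base
  (`ZariskiDVR.geometricallyIntegral_fibre_of_isDedekindDomain_of_smooth`: geometrically irreducible by
  Zariski, geometrically reduced because smooth), for `K` and `k₀` perfect (automatic in
  characteristic `0`); `specialFibreAbelianVariety_X` (`rfl`);
* `specialFibreAbelianVarietyOfIso` — the same with the generic-fibre hypothesis supplied by an iso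
  `(Over.pullback (Spec K → Spec R)).obj 𝒜 ≅ E`, `E` geometrically integral (the shape
  `∃ e : (genericFibre R K).obj 𝒜.X ≅ E` of `exists_abelianScheme_away`).

This is the Dedekind-base analogue of `IsAbelianSchemeModel.specialFibre`
(`Literature/NumberTheory/DiophantineGeometry/AbelianSchemeModelSpecialFibre.lean`, number rings
`𝓞_{K,v}`), written for the induction on transcendence degree in the route to FACT-LIST row F-0369
([AbsTopIII] Rmk. 1.5.4 (i): sub-`p`-adic fields are Kummer-faithful; memo F0369-FG-ROUTE §5, cell
abc-iut). One definition (`specialFibreAbelianVariety`, plus its `OfIso` wrapper and the functor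
abbreviation); no Prop-valued named facts; nothing here bears on [IUTchIII] Cor. 3.12.

## References

* [SerreTate1968GoodReduction] J.-P. Serre, J. Tate, *Good reduction of abelian varieties*, Ann. of
  Math. 88 (1968), §1.
* [Milne1986AbelianVarieties] J. S. Milne, *Abelian Varieties*, §20, Rem. 20.9.
* The Stacks Project, Tags 0E0N, 056T. [StacksProject]
-/

noncomputable section

universe u

open CategoryTheory CategoryTheory.Limits AlgebraicGeometry
open scoped MonObj CategoryTheory.Obj

namespace Literature.AlgebraicGeometry.Motives.ZariskiDVR

variable {R K : Type u} [CommRing R] [IsDedekindDomain R] [Field K] [Algebra R K] [IsFractionRing R K]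
  {k₀ : Type u} [Field k₀] (q : R →+* k₀)

/-- The **special fibre functor** `𝒳 ↦ 𝒳 ×_R k₀` along a closed point `q : R ↠ k₀`: Mathlib's
`Over.pullback` along `Spec k₀ → Spec R`.  It is monoidal for the cartesian monoidal structures, so
special fibres of group schemes are group schemes (`Functor.grpObjObj`, an instance under
`open scoped CategoryTheory.Obj`). [cite: SerreTate1968GoodReduction, §1] -/
abbrev specialFibreFunctor : SchemeOver R ⥤ SchemeOver k₀ :=
  Over.pullback (Spec.map (CommRingCat.ofHom q))

omit [IsDedekindDomain R] [IsFractionRing R K] in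
/-- **Geometric irreducibility of the generic fibre from a `K`-isomorphism with a geometrically
integral `K`-scheme** (e.g. an abelian variety): if `𝒜_K = 𝒜 ×_R K ≅ E` over `K` and `E → Spec K` is
geometrically integral, then `𝒜_K → Spec K` is geometrically irreducible (transport along the
isomorphism of `K`-schemes; `GeometricallyIrreducible` respects isomorphisms). This is the generic-fibre
hypothesis of `ZariskiDVR.geometricallyIntegral_fibre_of_isDedekindDomain(_of_smooth)` in the shape
`∃ e : (genericFibre R K).obj 𝒜 ≅ E` produced by `exists_abelianScheme_away`.
[cite: StacksProject, Tag 0E0N (hypothesis: geometrically irreducible generic fibre)] -/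
theorem geometricallyIrreducible_genericFibre_of_iso (𝒜 : SchemeOver R) (E : SchemeOver K)
    [GeometricallyIntegral E.hom]
    (e : (Over.pullback (Spec.map (CommRingCat.ofHom (algebraMap R K)))).obj 𝒜 ≅ E) :
    GeometricallyIrreducible (pullback.snd 𝒜.hom (Spec.map (CommRingCat.ofHom (algebraMap R K)))) := by
  have h : pullback.snd 𝒜.hom (Spec.map (CommRingCat.ofHom (algebraMap R K))) = e.hom.left ≫ E.hom :=
    (Over.w e.hom).symm
  haveI : @IsIso Scheme _ (pullback 𝒜.hom (Spec.map (CommRingCat.ofHom (algebraMap R K)))) E.left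
      e.hom.left :=
    inferInstanceAs (IsIso ((Over.forget _).mapIso e).hom)
  haveI : GeometricallyIrreducible E.hom := inferInstance
  rw [h]
  exact MorphismProperty.RespectsIso.precomp (P := @GeometricallyIrreducible) _ _ ‹_›

variable [PerfectField K] [PerfectField k₀]

/-- **The special fibre of a proper smooth group scheme over a Dedekind domain, at a closed point, is
an abelian variety** (given a geometrically irreducible generic fibre). For `R` Dedekind with perfect
fraction field `K`, `q : R ↠ k₀` a surjection onto a perfect field with `ker q ≠ ⊥`, and
`𝒜 → Spec R` a proper smooth group scheme with `𝒜_K` geometrically irreducible, the `k₀`-group scheme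
`𝒜 ×_R k₀` is an abelian variety: proper (base change) and geometrically integral
(`ZariskiDVR.geometricallyIntegral_fibre_of_isDedekindDomain_of_smooth` — Zariski's connectedness
theorem for irreducibility, smoothness for reducedness). Serre–Tate §1 "the special fibre is an abelian
variety over `k(v)`", over an arbitrary Dedekind base. [cite: SerreTate1968GoodReduction, §1] -/
def specialFibreAbelianVariety (hq : Function.Surjective q) (hq0 : RingHom.ker q ≠ ⊥)
    (𝒜 : SchemeOver R) [GrpObj 𝒜] [IsProper 𝒜.hom] [Smooth 𝒜.hom]
    [GeometricallyIrreducible (pullback.snd 𝒜.hom (Spec.map (CommRingCat.ofHom (algebraMap R K))))] :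
    AbelianVariety k₀ where
  X := (specialFibreFunctor q).obj 𝒜
  isProper := MorphismProperty.baseChange_obj _ _ ‹_›
  geometricallyIntegral :=
    geometricallyIntegral_fibre_of_isDedekindDomain_of_smooth (K := K) 𝒜.hom q hq hq0

/-- The underlying `k₀`-scheme of `specialFibreAbelianVariety` is `𝒜 ×_R k₀` (by `rfl`).
[cite: SerreTate1968GoodReduction, §1] -/
theorem specialFibreAbelianVariety_X (hq : Function.Surjective q) (hq0 : RingHom.ker q ≠ ⊥)
    (𝒜 : SchemeOver R) [GrpObj 𝒜] [IsProper 𝒜.hom] [Smooth 𝒜.hom]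
    [GeometricallyIrreducible (pullback.snd 𝒜.hom (Spec.map (CommRingCat.ofHom (algebraMap R K))))] :
    (specialFibreAbelianVariety (K := K) q hq hq0 𝒜).X = (specialFibreFunctor q).obj 𝒜 := rfl

/-- The structure morphism of the special-fibre abelian variety is the base change
`pullback.snd (𝒜 → Spec R) (Spec k₀ → Spec R)` (by `rfl`). [cite: SerreTate1968GoodReduction, §1] -/
theorem specialFibreAbelianVariety_hom (hq : Function.Surjective q) (hq0 : RingHom.ker q ≠ ⊥)
    (𝒜 : SchemeOver R) [GrpObj 𝒜] [IsProper 𝒜.hom] [Smooth 𝒜.hom]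
    [GeometricallyIrreducible (pullback.snd 𝒜.hom (Spec.map (CommRingCat.ofHom (algebraMap R K))))] :
    (specialFibreAbelianVariety (K := K) q hq hq0 𝒜).X.hom =
      pullback.snd 𝒜.hom (Spec.map (CommRingCat.ofHom q)) := rfl

/-- **The special fibre of the spread-out abelian scheme is an abelian variety**, in the shape of
`exists_abelianScheme_away`: for `𝒜 → Spec R` a proper smooth group scheme with a `K`-isomorphism
`𝒜_K ≅ E` to a geometrically integral `K`-scheme `E` (e.g. `E = A.X` for an abelian variety `A/K`,
`e : (genericFibre R K).obj 𝒜 ≅ A.X`), the special fibre at the closed point `q : R ↠ k₀` is an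
abelian variety over `k₀`. [cite: SerreTate1968GoodReduction, §1] [cite: Milne1986AbelianVarieties, Rem. 20.9 (§20, p. 146)] -/
def specialFibreAbelianVarietyOfIso (hq : Function.Surjective q) (hq0 : RingHom.ker q ≠ ⊥)
    (𝒜 : SchemeOver R) [GrpObj 𝒜] [IsProper 𝒜.hom] [Smooth 𝒜.hom] (E : SchemeOver K)
    [GeometricallyIntegral E.hom]
    (e : (Over.pullback (Spec.map (CommRingCat.ofHom (algebraMap R K)))).obj 𝒜 ≅ E) :
    AbelianVariety k₀ :=
  haveI := geometricallyIrreducible_genericFibre_of_iso (K := K) 𝒜 E e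
  specialFibreAbelianVariety (K := K) q hq hq0 𝒜

/-- The underlying `k₀`-scheme of `specialFibreAbelianVarietyOfIso` is `𝒜 ×_R k₀` (by `rfl`).
[cite: SerreTate1968GoodReduction, §1] -/
theorem specialFibreAbelianVarietyOfIso_X (hq : Function.Surjective q) (hq0 : RingHom.ker q ≠ ⊥)
    (𝒜 : SchemeOver R) [GrpObj 𝒜] [IsProper 𝒜.hom] [Smooth 𝒜.hom] (E : SchemeOver K)
    [GeometricallyIntegral E.hom]
    (e : (Over.pullback (Spec.map (CommRingCat.ofHom (algebraMap R K)))).obj 𝒜 ≅ E) :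
    (specialFibreAbelianVarietyOfIso (K := K) q hq hq0 𝒜 E e).X = (specialFibreFunctor q).obj 𝒜 := rfl

/-- For an abelian variety `A/K` and a proper smooth group scheme `𝒜/R` with `𝒜_K ≅ A.X` over `K`,
the special fibre at `q` is an abelian variety (specialisation of `specialFibreAbelianVarietyOfIso`
to `E := A.X`). [cite: SerreTate1968GoodReduction, §1] -/
def specialFibreAbelianVarietyOfAbelianVariety (hq : Function.Surjective q)
    (hq0 : RingHom.ker q ≠ ⊥) (𝒜 : SchemeOver R) [GrpObj 𝒜] [IsProper 𝒜.hom] [Smooth 𝒜.hom]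
    (A : AbelianVariety K)
    (e : (Over.pullback (Spec.map (CommRingCat.ofHom (algebraMap R K)))).obj 𝒜 ≅ A.X) :
    AbelianVariety k₀ :=
  specialFibreAbelianVarietyOfIso (K := K) q hq hq0 𝒜 A.X e

end Literature.AlgebraicGeometry.Motives.ZariskiDVR

end
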